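import Mathlib
import Summits.AnomalousDissipation.AnomalousDissipation.Theses.LimitingAbsorption
import Literature.Analysis.FluidPDE.LerayHopfMomentum
import Literature.Analysis.FluidPDE.DoeringFoiasPowerProofs

/-!
# Sketch — crux-ideate round 2, ideator 5, crux `FloorUpgrade` (stmt-AnomalousDissipation-15010)

Card `conserved-drift-phase-locking`.  Two checked facts:

* `LimsupFamilyFloor` (FIRST LEMMA, K1′): the SAME-FAMILY floor along a SUBSEQUENCE — for every relaxing
  family there is `ε > 0` such that for INFINITELY MANY `j` the `h`-sourced scalar from zero datum has
  limsup-mean dissipation `≥ ε`.  `floorUpgrade_of_limsupFamilyFloor : LimsupFamilyFloor → FloorUpgrade`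
  (proved: extract the sub-family).  This is weaker than the dead line's K1 (`∃ ε ∀ j`), and it is the exact
  same-family content of the crux: an enemy of `FloorUpgrade` inside the given family must have
  `P_j → 0` along the WHOLE index set.
* `drift_const` (momentum rigidity, in tree): the drift `m_j := ∫ v_j(t) dx` of a member of a relaxing
  family is time-independent on `(0, ∞)` — the only coherent translational sweep an NS family can have is
  a constant Galilean drift (no oscillatory uniform sweeping); `drift_sq_le_meanEnergy` (proved):
  `‖m_j‖² ≤ meanEnergy v_j`, so the carrier frequencies `2πk·m_j` lie in the band `|ω_k| ≤ 2π|k|√E`.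
-/

namespace Summit.AnomalousDissipation.AnomalousDissipation.Cruxes.FloorUpgrade.Ideator5

open Filter MeasureTheory Set
open Literature.Analysis Literature.Analysis.FluidPDE Literature.Analysis.FluidPDE.Torus
open Summit.AnomalousDissipation.AnomalousDissipation.Theses.LimitingAbsorption

set_option linter.dupNamespace false

/-- **K1′ — same-family floor along a subsequence** (FIRST LEMMA of card `conserved-drift-phase-locking`).
For every witness of `RelaxingFamily` (its data and clauses, verbatim) there is `ε > 0` such that for
infinitely many `j` some (= the unique) weak solution of the `h`-sourced scalar problem from zero datum in
the drift `v_j` with diffusivity `ν_j` has limsup-mean `ν_j‖∇θ‖² ≥ ε`. [folklore] -/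
def LimsupFamilyFloor : Prop :=
  ∀ (g : UnitAddTorus (Fin 2) → EuclideanSpace ℝ (Fin 2)) (h : UnitAddTorus (Fin 2) → ℝ),
    FunctionSpaces.Torus.IsSmooth g → FunctionSpaces.Torus.IsDivFree g →
    FunctionSpaces.Torus.HasZeroMean g → FunctionSpaces.Torus.IsSmooth h →
    FunctionSpaces.Torus.HasZeroMean h → h ≠ 0 →
    ∀ (ν : ℕ → ℝ) (v₀ : ℕ → UnitAddTorus (Fin 2) → EuclideanSpace ℝ (Fin 2))
      (v : ℕ → ℝ → UnitAddTorus (Fin 2) → EuclideanSpace ℝ (Fin 2)),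
      (∀ j, 0 < ν j) → Tendsto ν atTop (nhds 0) →
      (∀ j, IsGlobalLerayHopf (ν j) (fun _ => g) (v₀ j) (v j)) →
      (∀ j : ℕ, ∀ (T : ℝ), 0 < T →
        MemLp (FunctionSpaces.Torus.stLift (v j)) ⊤ (volume.restrict (Ioo (0 : ℝ) T ×ˢ univ))) →
      ∀ E : ℝ, (∀ j, meanEnergy (v j) ≤ E) →
      ∀ C γ : ℝ, 0 ≤ C → 0 < γ →
      (∀ (j : ℕ) (s : ℝ), 0 ≤ s → ∀ (T : ℝ) (θ : ℝ → UnitAddTorus (Fin 2) → ℝ),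
        IsWeakScalarTransportOn T (ν j) (fun t => v j (s + t)) h θ →
          ∀ᵐ t ∂(volume.restrict (Ioo (0 : ℝ) T)),
            scalarL2Sq (θ t) ≤ C * Real.exp (-(γ * t)) * scalarL2Sq h) →
      ∃ ε : ℝ, 0 < ε ∧ ∃ᶠ j in atTop, ∃ θ : ℝ → UnitAddTorus (Fin 2) → ℝ,
        IsWeakScalarTransportForced (ν j) (v j) (fun _ => h) 0 θ ∧
        ε ≤ longTimeAvgSup (fun t => ν j * (eScalarGradNormSq (θ t)).toReal)

/-- **K1′ ⟹ the crux**: extract the good sub-family (it inherits every clause of X; `ν ∘ φ → 0` because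
`φ` is strictly increasing). [folklore] -/
theorem floorUpgrade_of_limsupFamilyFloor (hK : LimsupFamilyFloor) : FloorUpgrade := by
  rintro ⟨g, h, hg, hgdiv, hgmean, hh, hhmean, hh0, ν, v₀, v, hνpos, hνlim, hLH, hbd, ⟨E, hE⟩, C, γ,
    hC, hγ, hrelax⟩
  obtain ⟨ε, hε, hfreq⟩ :=
    hK g h hg hgdiv hgmean hh hhmean hh0 ν v₀ v hνpos hνlim hLH hbd E hE C γ hC hγ hrelax
  obtain ⟨φ, hφ, hφP⟩ := Filter.extraction_of_frequently_atTop hfreq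
  exact ⟨g, h, hg, hgdiv, hgmean, hh, hhmean, fun j => ν (φ j), fun j => v₀ (φ j), fun j => v (φ j),
    fun j => hνpos (φ j), hνlim.comp hφ.tendsto_atTop, fun j => hLH (φ j), fun j => hbd (φ j),
    ⟨E, fun j => hE (φ j)⟩, ⟨C, γ, hC, hγ, fun j s hs => hrelax (φ j) s hs⟩, ε, hε, fun j => hφP j⟩

/-- **Momentum rigidity** (in tree, `IsGlobalLerayHopf.integral_eq_integral_of_hasZeroMean`): under a steady
smooth mean-zero force the drift `m := ∫ v(t) dx` of a global Leray–Hopf solution is the same at all positive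
times — an NS family cannot sweep a steady source back and forth coherently; its only coherent translational
sweep is the constant Galilean drift `m_j`. [folklore] -/
theorem drift_const {ν : ℝ} {g v₀ : UnitAddTorus (Fin 2) → EuclideanSpace ℝ (Fin 2)}
    {v : ℝ → UnitAddTorus (Fin 2) → EuclideanSpace ℝ (Fin 2)}
    (hv : IsGlobalLerayHopf ν (fun _ => g) v₀ v) (hg : FunctionSpaces.Torus.IsSmooth g)
    (hg0 : FunctionSpaces.Torus.HasZeroMean g) {s t : ℝ} (hs : 0 < s) (ht : 0 < t) :
    ∫ x, v t x = ∫ x, v s x :=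
  hv.integral_eq_integral_of_hasZeroMean (hg.memLp 2) hg0 hs ht

/-- **Doppler band**: the conserved drift is capped by the mean energy, `‖m_j‖² ≤ meanEnergy v_j (≤ E)` — Jensen on
the probability space `T²` slice by slice (`∫‖v − ∫v‖² = ∫‖v‖² − ‖∫v‖²`), momentum conservation, and the honest
(bounded) limsup of the running energy means (Doering–Foias). Hence the carrier frequencies of the card satisfy
`|ω_k| = 2π|k·m_j| ≤ 2π|k|√E`. [folklore] -/
theorem drift_sq_le_meanEnergy {ν : ℝ} (hν : 0 < ν) {g v₀ : UnitAddTorus (Fin 2) → EuclideanSpace ℝ (Fin 2)}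
    {v : ℝ → UnitAddTorus (Fin 2) → EuclideanSpace ℝ (Fin 2)}
    (hv : IsGlobalLerayHopf ν (fun _ => g) v₀ v) (hg : FunctionSpaces.Torus.IsSmooth g)
    (hg0 : FunctionSpaces.Torus.HasZeroMean g) :
    ‖∫ x, v 1 x‖ ^ 2 ≤ meanEnergy v := by
  set m : EuclideanSpace ℝ (Fin 2) := ∫ x, v 1 x with hm
  -- slice-wise Jensen + momentum conservation
  have hpt : ∀ t, 0 < t → ‖m‖ ^ 2 ≤ ∫ x, ‖v t x‖ ^ 2 := by
    intro t ht
    have hmt : ∫ x, v t x = m := drift_const hv hg hg0 one_pos ht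
    have hvar := integral_norm_sub_integral_sq (hv.memLp_two ht.le)
    have h0 : 0 ≤ ∫ x, ‖v t x - ∫ y, v t y‖ ^ 2 := integral_nonneg fun _ => sq_nonneg _
    rw [hmt] at hvar h0
    linarith
  -- running means
  have hmean : ∀ T, 0 < T → ‖m‖ ^ 2 ≤ timeMean (fun t => ∫ x, ‖v t x‖ ^ 2) T := by
    intro T hT
    have hint : IntervalIntegrable (fun t => ∫ x, ‖v t x‖ ^ 2) volume 0 T :=
      (intervalIntegrable_iff_integrableOn_Ioc_of_le hT.le).2 (hv.integrableOn_integral_norm_sq hT)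
    have hle : ∫ t in (0 : ℝ)..T, (fun _ => ‖m‖ ^ 2) t ≤ ∫ t in (0 : ℝ)..T, (∫ x, ‖v t x‖ ^ 2) :=
      intervalIntegral.integral_mono_ae_restrict hT.le intervalIntegrable_const hint (by
        have h0 : ∀ᵐ t ∂(volume : Measure ℝ), t ≠ 0 := by
          have hc : ({0}ᶜ : Set ℝ) ∈ ae (volume : Measure ℝ) := compl_mem_ae_iff.2 (measure_singleton 0)
          filter_upwards [hc] with t ht
          simpa using ht
        filter_upwards [ae_restrict_mem measurableSet_Icc, ae_restrict_of_ae h0] with t ht ht0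
        exact hpt t (lt_of_le_of_ne ht.1 (Ne.symm ht0)))
    rw [intervalIntegral.integral_const, smul_eq_mul, sub_zero] at hle
    unfold timeMean
    have hT' : T⁻¹ * (T * ‖m‖ ^ 2) = ‖m‖ ^ 2 := by field_simp
    calc ‖m‖ ^ 2 = T⁻¹ * (T * ‖m‖ ^ 2) := hT'.symm
      _ ≤ T⁻¹ * ∫ t in (0 : ℝ)..T, ∫ x, ‖v t x‖ ^ 2 :=
          mul_le_mul_of_nonneg_left hle (inv_nonneg.2 hT.le)
  -- limsup: bounded running means (Doering–Foias) + frequent lower bound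
  have hbdd : IsBoundedUnder (· ≤ ·) atTop (timeMean fun t => ∫ x, ‖v t x‖ ^ 2) :=
    Filter.isBoundedUnder_of_eventually_le
      ((eventually_ge_atTop (1 : ℝ)).mono fun T hT =>
        Torus.IsGlobalLerayHopf.timeMean_norm_sq_le hν hg hg0 hv hT)
  have hfreq : ∃ᶠ T in atTop, ‖m‖ ^ 2 ≤ timeMean (fun t => ∫ x, ‖v t x‖ ^ 2) T :=
    ((eventually_gt_atTop (0 : ℝ)).mono fun T hT => hmean T hT).frequently
  rw [meanEnergy_eq_longTimeAvgSup]
  exact Filter.le_limsup_of_frequently_le hfreq hbdd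

/-- Consequence used by the card: the crux follows from K1′, and a refutation of the crux inside a given
family needs `P_j → 0` along ALL of `j` (not just a subsequence). [folklore] -/
example (hK : LimsupFamilyFloor) : RelaxingFamily → UniformRelaxationWitness :=
  floorUpgrade_of_limsupFamilyFloor hK

end Summit.AnomalousDissipation.AnomalousDissipation.Cruxes.FloorUpgrade.Ideator5
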